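import Summits.AtomisticToContinuum.FouriersLaw.Theorems.PhononMeanFreePathDefs
import Summits.AtomisticToContinuum.FouriersLaw.Theorems.PhononMeanFreePathIncoherentChannelTimeReversal
import Summits.AtomisticToContinuum.FouriersLaw.Theorems.PhononMeanFreePathCoherentDephasingHeadBound

/-!
# `CoherentDephasing` / line `Sketch`: the coherent position field is bounded by the kick (stub `sum_posResp_sq_le`)

Registered stub `sum_posResp_sq_le` of line `Sketch` of crux `PhononMeanFreePath.CoherentDephasing`
(stmt-AtomisticToContinuum-11810). For the `(N+1)`-site pinned anharmonic chain `P = pinnedChain ω₂ lam β γ`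
(pinning `U(q) = ω₂ q²/2 + lam q⁴/4`, coupling `V(r) = r²/2 + β r⁴/4`) with both Langevin baths at `T`, Gibbs
law `μ = P.gibbsMeasure (N+1) T` and constructed kernels `K_t = P.transitionKernel (N+1) T T t⁺`, the position
component of the coherent response field is `n_x(t) = ⟨p₀, K_t q_x⟩_μ = posResp … N x t`
(`Theorems/PhononMeanFreePathDefs`). CLAIM: `Σ_x n_x(t)² ≤ T² / min(ω₂, 1)` for every `N` and every `t`
(uniformly in `N`, pointwise in time).

PROOF (duality + Poincaré + contraction). Put `S = Σ_x n_x(t)²` and let `G = Σ_x n_x(t) q_x`, a LINEAR function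
of the positions. By linearity of the kernel average, `S = Σ_x n_x ⟨p₀, K_t q_x⟩_μ = ⟨p₀, K_t G⟩_μ`
(`sq_sum_mul_kick_position_le`), so by Cauchy–Schwarz in `L²(μ)`
(`PhononMeanFreePath.timeReversal_sq_integral_mul_le`)

  `S² ≤ ‖p₀‖²_{L²(μ)} · ‖K_t G‖²_{L²(μ)} ≤ T · ‖G‖²_{L²(μ)}`,

using the Gibbs second moment `∫ p₀² dμ = T` (`GibbsStein.gibbs_sq_momentum`) and the `L²(μ)`-contraction of
the Markov kernel under its invariant law (`SubdiffusiveBondHeat.pinnedChain_sq_act_le_of_sq_integrable`,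
Jensen + `μ K_t = μ`). Finally `‖G‖²_{L²(μ)} = Var_μ(G) ≤ (T / min(ω₂,1)) Σ_x n_x²`
(`sq_integral_linear_position_le`): the positions are odd under `q ↦ -q`, which preserves `e^{-H/T} dq dp`
(`GibbsMoments.integral_position_mul_gibbsDensity`), so `∫ G dμ = 0`, and the `N`-UNIFORM Brascamp–Lieb
Poincaré inequality for the Gibbs weight (`SubBallisticWindow.GibbsPoincare.stub_gibbsPoincare`, fed in as a
hypothesis of the generic lemma and discharged by the proved tree fact) applies to `G ∈ C¹` with
`∂_{q_i} G ≡ n_i`, `∂_{p_i} G ≡ 0`; dividing by the partition function moves it to `μ`.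
Hence `S² ≤ T · (T / min(ω₂,1)) · S`, i.e. `S ≤ T² / min(ω₂,1)`.
-/

noncomputable section

open MeasureTheory ProbabilityTheory Set Filter Topology
open scoped NNReal ENNReal

namespace Summit.AtomisticToContinuum.FouriersLaw.Theorems.CoherentDephasing.CoherentPositionPointwise

open Literature.MathematicalPhysics.KineticTheory.HeatConduction
open Summit.AtomisticToContinuum.FouriersLaw.Theorems.PhononMeanFreePath
open Summit.AtomisticToContinuum.FouriersLaw.Theorems.SubdiffusiveBondHeat
  (pinnedChain_sq_act_le_of_sq_integrable integrable_mul_of_sq_aesm integrable_of_abs_le_exp)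
open Summit.AtomisticToContinuum.FouriersLaw.Theorems.IncoherentChannel.Negative.KernelMoments
  (integrable_exp_hamiltonian_transitionKernel)
open Summit.AtomisticToContinuum.FouriersLaw.Theorems.IncoherentChannel.Negative.GibbsStein (gibbs_sq_momentum)
open Summit.AtomisticToContinuum.FouriersLaw.Theorems.CoherentDephasing.HeadBound
  (abs_position_pow_le_exp integrable_position_pow)
open Summit.AtomisticToContinuum.FouriersLaw.Theorems.SubBallisticWindow.GibbsMoments
  (integral_gibbs integrable_gibbs_iff integrable_pow_gibbs abs_position_le integral_position_mul_gibbsDensity)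
open Summit.AtomisticToContinuum.FouriersLaw.Theorems.LightConeBondHeat
  (pinnedChain_integrable_mul_gibbsDensity_of_le_pow)

/-! ### Poincaré step: the Gibbs variance of a linear function of the positions -/

/-- **Gibbs second moment of a linear function of the positions.** For the pinned chain (`ω₂ > 0`,
`lam, β ≥ 0`, any `γ`, `T > 0`, any `N`) and coefficients `a : Fin N → ℝ`, the observable `G = Σ_i a_i q_i`
satisfies `G² ∈ L¹(μ_T)` and `∫ G² dμ_T ≤ (T / min(ω₂,1)) Σ_i a_i²`, GIVEN the Poincaré inequality for the Gibbs
weight `μ = e^{-H/T} dq dp` (the statement of `SubBallisticWindow.GibbsPoincare.stub_gibbsPoincare` at this `N`,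
taken as the hypothesis `hP`): `∫ G dμ = 0` (positions are odd, `integral_position_mul_gibbsDensity`),
`∂_{q_i} G ≡ a_i`, `∂_{p_i} G ≡ 0`, and division by the partition function `Z`. [folklore] -/
theorem sq_integral_linear_position_le {ω₂ lam β : ℝ} (hω : 0 < ω₂) (hl : 0 ≤ lam) (hβ : 0 ≤ β) (γ : ℝ)
    (N : ℕ) {T : ℝ} (hT : 0 < T) {μ : Measure (PhaseSpace N)} {Z : ℝ}
    (hμ : μ = volume.withDensity fun x : PhaseSpace N =>
      ENNReal.ofReal (Real.exp (-((pinnedChain ω₂ lam β γ).hamiltonian N x) / T)))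
    (hZ : Z = ∫ x : PhaseSpace N, Real.exp (-((pinnedChain ω₂ lam β γ).hamiltonian N x) / T))
    (hP : ∀ G : PhaseSpace N → ℝ, ContDiff ℝ 1 G → MemLp G 2 μ →
      Integrable (fun x => ∑ j : Fin N, ((partialQ j G x) ^ 2 + (partialP j G x) ^ 2)) μ →
      ∫ x, (G x - (∫ y, G y ∂μ) / Z) ^ 2 ∂μ ≤
        T / min ω₂ 1 * ∫ x, (∑ j : Fin N, ((partialQ j G x) ^ 2 + (partialP j G x) ^ 2)) ∂μ)
    (a : Fin N → ℝ) :
    Integrable (fun y : PhaseSpace N => (∑ i, a i * y.1 i) ^ 2) ((pinnedChain ω₂ lam β γ).gibbsMeasure N T) ∧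
      ∫ y, (∑ i, a i * y.1 i) ^ 2 ∂((pinnedChain ω₂ lam β γ).gibbsMeasure N T) ≤ T / min ω₂ 1 * ∑ i, a i ^ 2 := by
  have hZ' : Z = ∫ x, (pinnedChain ω₂ lam β γ).gibbsDensity N T x := hZ
  have hZpos : 0 < Z := by
    rw [hZ']
    exact integral_exp_pos (pinnedChain_integrable_gibbsDensity hω hl hβ γ N hT)
  -- the linear observable
  set G : PhaseSpace N → ℝ := fun y => ∑ i, a i * y.1 i with hG
  have hGc : Continuous G := by
    rw [hG]
    fun_prop
  have hG1 : ContDiff ℝ 1 G := by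
    rw [hG]
    exact ContDiff.sum fun i _ => contDiff_const.mul ((contDiff_apply ℝ ℝ i).comp contDiff_fst)
  have hGH : ∀ y, |G y| ≤ ((∑ i, |a i|) * (1 + ω₂⁻¹)) * (1 + (pinnedChain ω₂ lam β γ).hamiltonian N y) := by
    intro y
    calc |G y| = |∑ i, a i * y.1 i| := rfl
      _ ≤ ∑ i, |a i * y.1 i| := Finset.abs_sum_le_sum_abs _ _
      _ ≤ ∑ i, |a i| * ((1 + ω₂⁻¹) * (1 + (pinnedChain ω₂ lam β γ).hamiltonian N y)) :=
          Finset.sum_le_sum fun i _ => by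
            rw [abs_mul]
            exact mul_le_mul_of_nonneg_left (abs_position_le hω hl hβ γ N y i) (abs_nonneg _)
      _ = ((∑ i, |a i|) * (1 + ω₂⁻¹)) * (1 + (pinnedChain ω₂ lam β γ).hamiltonian N y) := by
          rw [Finset.sum_mul, Finset.sum_mul]
          exact Finset.sum_congr rfl fun i _ => by ring
  have hGk : ∀ k : ℕ, Integrable (fun y => G y ^ k) μ := integrable_pow_gibbs γ N hω hl hβ hT hμ hGc hGH
  -- partial derivatives of the linear observable
  have hQ : ∀ (i : Fin N) (z : PhaseSpace N), partialQ i G z = a i := by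
    intro i z
    show deriv (fun t => ∑ j, a j * Function.update z.1 i t j) (z.1 i) = a i
    have h : ∀ t : ℝ, (∑ j, a j * Function.update z.1 i t j) =
        a i * t + ∑ j ∈ Finset.univ.erase i, a j * z.1 j := by
      intro t
      rw [← Finset.add_sum_erase Finset.univ _ (Finset.mem_univ i), Function.update_self]
      congr 1
      exact Finset.sum_congr rfl fun j hj => by rw [Function.update_of_ne (Finset.ne_of_mem_erase hj)]
    simp_rw [h]
    have hd : HasDerivAt (fun t : ℝ => a i * t + ∑ j ∈ Finset.univ.erase i, a j * z.1 j) (a i) (z.1 i) := by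
      simpa using ((hasDerivAt_id (z.1 i)).const_mul (a i)).add_const (∑ j ∈ Finset.univ.erase i, a j * z.1 j)
    exact hd.deriv
  have hPz : ∀ (i : Fin N) (z : PhaseSpace N), partialP i G z = 0 := fun i z => by
    show deriv (fun _ : ℝ => ∑ j, a j * z.1 j) (z.2 i) = 0
    exact deriv_const _ _
  have hgrad : ∀ z : PhaseSpace N,
      (∑ j : Fin N, ((partialQ j G z) ^ 2 + (partialP j G z) ^ 2)) = ∑ j, a j ^ 2 := fun z =>
    Finset.sum_congr rfl fun j _ => by rw [hQ, hPz]; ring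
  -- the hypotheses of the Poincaré inequality
  have hGmem : MemLp G 2 μ := (memLp_two_iff_integrable_sq hGc.aestronglyMeasurable).2 (hGk 2)
  have hconst_int : ∀ c : ℝ, Integrable (fun _ : PhaseSpace N => c) μ := fun c => by
    rw [integrable_gibbs_iff γ N hμ]
    exact (pinnedChain_integrable_gibbsDensity hω hl hβ γ N hT).const_mul c
  have hconst : ∀ c : ℝ, ∫ _x, c ∂μ = c * Z := fun c => by
    rw [integral_gibbs γ N hμ, integral_const_mul, ← hZ']
  have hgradI : Integrable (fun z => ∑ j : Fin N, ((partialQ j G z) ^ 2 + (partialP j G z) ^ 2)) μ :=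
    (hconst_int (∑ j, a j ^ 2)).congr (Eventually.of_forall fun z => (hgrad z).symm)
  -- the mean vanishes: positions are odd
  have hmean : ∫ y, G y ∂μ = 0 := by
    rw [integral_gibbs γ N hμ]
    show ∫ x, (∑ i, a i * x.1 i) * (pinnedChain ω₂ lam β γ).gibbsDensity N T x = 0
    simp_rw [Finset.sum_mul, mul_assoc]
    rw [integral_finsetSum _ fun i _ => ?_]
    · refine Finset.sum_eq_zero fun i _ => ?_
      rw [integral_const_mul, integral_position_mul_gibbsDensity, mul_zero]
    · exact (pinnedChain_integrable_mul_gibbsDensity_of_le_pow hω hl hβ γ N hT 1 (by fun_prop)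
        (fun x => by rw [pow_one]; exact abs_position_le hω hl hβ γ N x i)).const_mul (a i)
  -- the Poincaré inequality for `G`
  have hPI := hP G hG1 hGmem hgradI
  rw [hmean, zero_div] at hPI
  simp_rw [sub_zero, hgrad] at hPI
  rw [hconst] at hPI
  -- back to the normalised Gibbs measure
  have hI2 : Integrable (fun y => G y ^ 2) ((pinnedChain ω₂ lam β γ).gibbsMeasure N T) :=
    (pinnedChain ω₂ lam β γ).integrable_gibbsMeasure ((integrable_gibbs_iff γ N hμ _).1 (hGk 2))
  refine ⟨hI2, ?_⟩
  show ∫ y, G y ^ 2 ∂((pinnedChain ω₂ lam β γ).gibbsMeasure N T) ≤ T / min ω₂ 1 * ∑ i, a i ^ 2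
  rw [(pinnedChain ω₂ lam β γ).integral_gibbsMeasure, ← hZ', ← integral_gibbs γ N hμ]
  have hZne : Z ≠ 0 := hZpos.ne'
  calc Z⁻¹ * ∫ x, G x ^ 2 ∂μ ≤ Z⁻¹ * (T / min ω₂ 1 * ((∑ j, a j ^ 2) * Z)) :=
        mul_le_mul_of_nonneg_left hPI (inv_nonneg.2 hZpos.le)
    _ = T / min ω₂ 1 * ∑ i, a i ^ 2 := by
        field_simp

/-! ### Kernel step: duality, Cauchy–Schwarz, contraction -/

section Kernel

variable {ω₂ lam β γ T : ℝ} (hω : 0 < ω₂) (hl : 0 < lam) (hβ : 0 < β) (hγ : 0 < γ) (hT : 0 < T)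
include hω hl hβ hγ hT

/-- **The kick response of a linear function of the positions is controlled by its coefficients.** For the
`(N+1)`-site pinned chain with both baths at `T`, `μ = μ_T`, `K = K_u` (`u ≥ 0`) and `a : Fin (N+1) → ℝ`:
`(Σ_x a_x ⟨p₀, K q_x⟩_μ)² ≤ T · (T / min(ω₂,1)) · Σ_x a_x²` — linearity `Σ_x a_x K q_x = K G` (`G = Σ a_x q_x`),
Cauchy–Schwarz, `∫ p₀² dμ = T`, the `L²(μ)`-contraction `‖K G‖ ≤ ‖G‖` and the Poincaré bound
`‖G‖² ≤ (T / min(ω₂,1)) Σ a_x²` (`sq_integral_linear_position_le` fed with `stub_gibbsPoincare`). [folklore] -/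
theorem sq_sum_mul_kick_position_le (N : ℕ) (u : ℝ≥0) (a : Fin (N + 1) → ℝ) :
    (∑ x, a x * ∫ z, z.2 0 * (∫ y, y.1 x ∂((pinnedChain ω₂ lam β γ).transitionKernel (N + 1) T T u z))
        ∂((pinnedChain ω₂ lam β γ).gibbsMeasure (N + 1) T)) ^ 2 ≤
      T * (T / min ω₂ 1 * ∑ x, a x ^ 2) := by
  set P := pinnedChain ω₂ lam β γ with hP
  set μ := P.gibbsMeasure (N + 1) T with hμ
  set κ := P.transitionKernel (N + 1) T T u with hκ
  -- Poincaré input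
  obtain ⟨hG2, hGP⟩ := sq_integral_linear_position_le hω hl.le hβ.le γ (N + 1) hT rfl rfl
    (SubBallisticWindow.GibbsPoincare.stub_gibbsPoincare ω₂ lam β γ hω hl.le hβ.le T hT (N + 1)) a
  -- measurability
  have hGc : Continuous fun y : PhaseSpace (N + 1) => ∑ x, a x * y.1 x := by fun_prop
  have hGm : Measurable fun y : PhaseSpace (N + 1) => ∑ x, a x * y.1 x := hGc.measurable
  have hp0m : Measurable fun z : PhaseSpace (N + 1) => z.2 0 := (measurable_pi_apply 0).comp measurable_snd
  have hqm : ∀ x, Measurable fun z : PhaseSpace (N + 1) => z.1 x := fun x =>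
    (measurable_pi_apply x).comp measurable_fst
  -- Gibbs second moments
  have hp2 : Integrable (fun z : PhaseSpace (N + 1) => z.2 0 ^ 2) μ :=
    lightCone_integrable_momentum_pow hω hl.le hβ.le hT 0 2
  have hq2 : ∀ x, Integrable (fun z : PhaseSpace (N + 1) => z.1 x ^ 2) μ := fun x =>
    integrable_position_pow hω hl.le hβ.le γ hT 2 (N + 1) x
  -- `L²(μ)`-contraction of the kernel
  obtain ⟨-, hKG2, hKGle⟩ := pinnedChain_sq_act_le_of_sq_integrable hω hl hβ hγ (Nat.succ_pos N) hT hGm hG2 u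
  have hKq2 : ∀ x, Integrable (fun z => (∫ y, y.1 x ∂κ z) ^ 2) μ := fun x =>
    (pinnedChain_sq_act_le_of_sq_integrable hω hl hβ hγ (Nat.succ_pos N) hT (hqm x) (hq2 x) u).2.1
  -- kernel integrability of the positions (every microstate)
  have hθ : (0 : ℝ) < 1 / (2 * T) := by positivity
  have hqκ : ∀ (z : PhaseSpace (N + 1)) (x : Fin (N + 1)),
      Integrable (fun y : PhaseSpace (N + 1) => y.1 x) (κ z) := fun z x =>
    integrable_of_abs_le_exp
      (integrable_exp_hamiltonian_transitionKernel hω hl.le hβ.le hγ.le (Nat.succ_pos N) hT u z)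
      (by fun_prop) fun y => by
        have h := abs_position_pow_le_exp hω hl.le hβ.le γ hθ 1 (N + 1) y x
        rwa [pow_one] at h
  -- linearity of the kernel average
  have hκG : ∀ z, ∫ y, (∑ x, a x * y.1 x) ∂κ z = ∑ x, a x * ∫ y, y.1 x ∂κ z := fun z => by
    rw [integral_finsetSum _ fun x _ => (hqκ z x).const_mul (a x)]
    exact Finset.sum_congr rfl fun x _ => integral_const_mul _ _
  -- integrability of `p₀ · K q_x` under `μ`
  have hI : ∀ x, Integrable (fun z => z.2 0 * ∫ y, y.1 x ∂κ z) μ := fun x =>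
    integrable_mul_of_sq_aesm hp0m.aestronglyMeasurable
      ((hqm x).stronglyMeasurable.integral_kernel (κ := κ)).aestronglyMeasurable hp2 (hKq2 x)
  -- duality: `Σ_x a_x ⟨p₀, K q_x⟩ = ⟨p₀, K G⟩`
  have h1 : ∑ x, a x * ∫ z, z.2 0 * (∫ y, y.1 x ∂κ z) ∂μ = ∫ z, z.2 0 * (∫ y, (∑ x, a x * y.1 x) ∂κ z) ∂μ := by
    calc ∑ x, a x * ∫ z, z.2 0 * (∫ y, y.1 x ∂κ z) ∂μ = ∑ x, ∫ z, a x * (z.2 0 * ∫ y, y.1 x ∂κ z) ∂μ :=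
          Finset.sum_congr rfl fun x _ => (integral_const_mul _ _).symm
      _ = ∫ z, ∑ x, a x * (z.2 0 * ∫ y, y.1 x ∂κ z) ∂μ :=
          (integral_finsetSum _ fun x _ => (hI x).const_mul (a x)).symm
      _ = ∫ z, z.2 0 * (∫ y, (∑ x, a x * y.1 x) ∂κ z) ∂μ :=
          integral_congr_ae (Eventually.of_forall fun z => by
            simp only [hκG z, Finset.mul_sum]
            exact Finset.sum_congr rfl fun x _ => by ring)
  rw [h1]
  -- Cauchy–Schwarz, `∫ p₀² dμ = T`, contraction, Poincaré
  have hCS := timeReversal_sq_integral_mul_le (μ := μ) hp2 hKG2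
  have hp2T : ∫ z : PhaseSpace (N + 1), z.2 0 ^ 2 ∂μ = T := gibbs_sq_momentum hω hl.le hβ.le hT 0
  calc _ ≤ (∫ z : PhaseSpace (N + 1), z.2 0 ^ 2 ∂μ) * ∫ z, (∫ y, (∑ x, a x * y.1 x) ∂κ z) ^ 2 ∂μ := hCS
    _ ≤ T * (T / min ω₂ 1 * ∑ x, a x ^ 2) := by
        rw [hp2T]
        exact mul_le_mul_of_nonneg_left (hKGle.trans hGP) hT.le

end Kernel

/-! ### The registered stub -/

/-- **Stub `sum_posResp_sq_le`** (line `Sketch` of crux `CoherentDephasing`): for the `(N+1)`-site pinned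
anharmonic chain with both baths at `T`, the position component `n_x(t) = ⟨p₀, K_t q_x⟩_{μ_T}` of the coherent
response field satisfies `Σ_x n_x(t)² ≤ T² / min(ω₂, 1)` for every `N` and every `t > 0`: with `S = Σ_x n_x²`,
`sq_sum_mul_kick_position_le` at `a_x = n_x(t)` reads `S² ≤ T · (T / min(ω₂,1)) · S`. [folklore] -/
theorem sum_posResp_sq_le :
    ∀ ω₂ lam β γ : ℝ, 0 < ω₂ → 0 < lam → 0 < β → 0 < γ → ∀ T : ℝ, 0 < T → ∀ (N : ℕ) (t : ℝ), 0 < t →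
      ∑ x : Fin (N + 1), posResp ω₂ lam β γ T N x t ^ 2 ≤ T ^ 2 / min ω₂ 1 := by
  intro ω₂ lam β γ hω hl hβ hγ T hT N t _
  have h := sq_sum_mul_kick_position_le hω hl hβ hγ hT N t.toNNReal (fun x => posResp ω₂ lam β γ T N x t)
  have he : (∑ x : Fin (N + 1), posResp ω₂ lam β γ T N x t *
      ∫ z, z.2 0 * (∫ y, y.1 x ∂((pinnedChain ω₂ lam β γ).transitionKernel (N + 1) T T t.toNNReal z))
        ∂((pinnedChain ω₂ lam β γ).gibbsMeasure (N + 1) T)) = ∑ x, posResp ω₂ lam β γ T N x t ^ 2 :=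
    Finset.sum_congr rfl fun x _ => by rw [sq]; rfl
  rw [he] at h
  set S := ∑ x : Fin (N + 1), posResp ω₂ lam β γ T N x t ^ 2 with hS
  have hS0 : 0 ≤ S := Finset.sum_nonneg fun x _ => sq_nonneg _
  have hK : T ^ 2 / min ω₂ 1 = T * (T / min ω₂ 1) := by ring
  rw [hK]
  rcases hS0.eq_or_lt with h0 | hpos
  · rw [← h0]
    exact mul_nonneg hT.le (div_nonneg hT.le (le_min hω.le zero_le_one))
  · rw [sq, ← mul_assoc] at h
    exact le_of_mul_le_mul_right h hpos

end Summit.AtomisticToContinuum.FouriersLaw.Theorems.CoherentDephasing.CoherentPositionPointwise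

end
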